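import Summits.RiemannHypothesis.RiemannHypothesis.Theorems.WeilGroundStateGroundStatesConvergeToXiMellinByParts
import Summits.RiemannHypothesis.RiemannHypothesis.Theorems.WeilGroundStateGroundStatesConvergeToXiStubZeroSideTruncation
import Literature.NumberTheory.LFunctions.WeilExplicit
import Mathlib.MeasureTheory.Integral.IntegralEqImproper
import Mathlib.MeasureTheory.Integral.IntervalIntegral.FundThmCalculus
import Mathlib.Analysis.SpecialFunctions.ImproperIntegrals
import Mathlib.Analysis.Calculus.ParametricIntegral
import Mathlib.Analysis.Calculus.ContDiff.Deriv
import HarnessLib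

/-!
# `WeilGroundState.GroundStatesConvergeToXi` — dividing the Mellin transform by a zero
(crux item stmt-RiemannHypothesis-1527, route route-RiemannHypothesis-WeilGroundState; line `Sketch`,
stub `stub_mellin_divide` (G5); `--supports`)

EXPONENTIAL WEIL CLASS: `F : ℝ → ℂ` smooth with `‖F‖, ‖F'‖, ‖F''‖ ≤ C e^{-b₀|t|}`, `b₀ > 1/2`.
If `F̂(s₀) = weilMellin F s₀ = 0` for some `s₀` in the open critical strip, put `w = s₀ − 1/2`
(`|Re w| < 1/2 < b₀`) and
`G(t) = −e^{−wt} ∫_{−∞}^t F(τ) e^{wτ} dτ  ( = +e^{−wt} ∫_t^∞ F(τ) e^{wτ} dτ`, since the total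
integral is `F̂(s₀) = 0`).  Then `G' = −w G − F` (product rule + FTC for the improper primitive),
`‖G(t)‖ ≤ C/(b₀ − |Re w|) · e^{−b₀|t|}` (left form for `t ≤ 0`, right form for `t ≥ 0`, with the
closed forms `∫_{Iic t} e^{aτ} = e^{at}/a`, `∫_{Ioi t} e^{aτ} = −e^{at}/a`), hence the same envelope
for `G'`, `G''`; `G` is smooth by bootstrapping `G' = −w G − F` (`contDiff_succ_iff_deriv`); and in
the closed strip `(G')^(s) = −(s − 1/2) Ĝ(s)` (`weilMellin_of_hasDerivAt`) gives
`F̂(s) = (s − s₀) Ĝ(s)`.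

No new definitions; no named fact is used.
-/

noncomputable section

set_option linter.dupNamespace false

open scoped Topology Real
open Filter Set MeasureTheory Complex

namespace Summit.RiemannHypothesis.RiemannHypothesis.Theorems.GroundStatesConvergeToXi

open Literature.NumberTheory.LFunctions

/-! ## Calculus of the primitive `t ↦ −e^{−wt} ∫_{−∞}^t f` -/

/-- `d/dt e^{wt} = w e^{wt}` along the real line. [folklore] -/
theorem mdiv_hasDerivAt_cexp (w : ℂ) (t : ℝ) :
    HasDerivAt (fun u : ℝ => cexp (w * u)) (w * cexp (w * t)) t := by
  have h1 : HasDerivAt (fun u : ℝ => w * (u : ℂ)) (w * 1) t :=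
    (Complex.ofRealCLM.hasDerivAt.const_mul w).congr_deriv (by simp)
  have h2 := (Complex.hasDerivAt_exp (w * t)).comp t h1
  simpa [mul_comm, Function.comp_def] using h2

/-- FTC for the improper primitive: for `f` continuous and integrable on `ℝ`,
`d/dt ∫_{−∞}^t f = f(t)`. [folklore] -/
theorem mdiv_hasDerivAt_primitive {f : ℝ → ℂ} (hc : Continuous f) (hi : Integrable f) (t : ℝ) :
    HasDerivAt (fun u : ℝ => ∫ τ in Iic u, f τ) (f t) t := by
  have heq : (fun u : ℝ => ∫ τ in Iic u, f τ) =
      fun u => (∫ τ in Iic (0 : ℝ), f τ) + ∫ τ in (0 : ℝ)..u, f τ := by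
    funext u
    rw [← intervalIntegral.integral_Iic_sub_Iic hi.integrableOn hi.integrableOn]
    ring
  rw [heq]
  exact ((hc.integral_hasStrictDerivAt 0 t).hasDerivAt).const_add _

/-- Product rule: `G(t) = −e^{−wt} ∫_{−∞}^t F(τ)e^{wτ} dτ` satisfies `G' = −w G − F`. [folklore] -/
theorem mdiv_hasDerivAt_G {F : ℝ → ℂ} (hFc : Continuous F) (w : ℂ)
    (hi : Integrable fun τ : ℝ => F τ * cexp (w * τ)) (t : ℝ) :
    HasDerivAt (fun u : ℝ => -(cexp (-w * u) * ∫ τ in Iic u, F τ * cexp (w * τ)))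
      (-w * -(cexp (-w * t) * ∫ τ in Iic t, F τ * cexp (w * τ)) - F t) t := by
  have hI := mdiv_hasDerivAt_primitive (f := fun τ : ℝ => F τ * cexp (w * τ)) (by fun_prop) hi t
  have h := ((mdiv_hasDerivAt_cexp (-w) t).mul hI).neg
  refine h.congr_deriv ?_
  have hexp : cexp (-w * t) * cexp (w * t) = 1 := by
    rw [← Complex.exp_add]
    simp
  linear_combination (-(F t)) * hexp

/-! ## The exponential envelope of the primitive -/

/-- Left tail: if `‖f(τ)‖ ≤ C e^{−b₀|τ|} e^{aτ}` with `b₀ + a > 0`, then for `t ≤ 0`,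
`‖∫_{−∞}^t f‖ ≤ C/(b₀ + a) · e^{(b₀ + a)t}`. [folklore] -/
theorem mdiv_norm_primitive_le_of_nonpos {f : ℝ → ℂ} (hi : Integrable f) {C b₀ a : ℝ}
    (hf : ∀ τ, ‖f τ‖ ≤ C * Real.exp (-(b₀ * |τ|)) * Real.exp (a * τ)) (hba : 0 < b₀ + a)
    {t : ℝ} (ht : t ≤ 0) :
    ‖∫ τ in Iic t, f τ‖ ≤ C / (b₀ + a) * Real.exp ((b₀ + a) * t) := by
  calc ‖∫ τ in Iic t, f τ‖ ≤ ∫ τ in Iic t, ‖f τ‖ := norm_integral_le_integral_norm _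
    _ ≤ ∫ τ in Iic t, C * Real.exp ((b₀ + a) * τ) := by
        refine setIntegral_mono_on hi.norm.integrableOn
          ((integrableOn_exp_mul_Iic hba t).const_mul C) measurableSet_Iic fun τ hτ => ?_
        have hτ0 : τ ≤ 0 := (mem_Iic.1 hτ).trans ht
        calc ‖f τ‖ ≤ C * Real.exp (-(b₀ * |τ|)) * Real.exp (a * τ) := hf τ
          _ = C * Real.exp ((b₀ + a) * τ) := by
              rw [abs_of_nonpos hτ0, mul_assoc, ← Real.exp_add]
              congr 2
              ring
    _ = C / (b₀ + a) * Real.exp ((b₀ + a) * t) := by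
        rw [integral_const_mul, integral_exp_mul_Iic hba]
        field_simp

/-- Right tail: if moreover `∫ f = 0` and `b₀ − a > 0`, then for `0 ≤ t`,
`‖∫_{−∞}^t f‖ = ‖∫_t^∞ f‖ ≤ C/(b₀ − a) · e^{(a − b₀)t}`. [folklore] -/
theorem mdiv_norm_primitive_le_of_nonneg {f : ℝ → ℂ} (hi : Integrable f) (h0 : ∫ τ, f τ = 0)
    {C b₀ a : ℝ} (hf : ∀ τ, ‖f τ‖ ≤ C * Real.exp (-(b₀ * |τ|)) * Real.exp (a * τ))
    (hba : 0 < b₀ - a) {t : ℝ} (ht : 0 ≤ t) :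
    ‖∫ τ in Iic t, f τ‖ ≤ C / (b₀ - a) * Real.exp ((a - b₀) * t) := by
  have hsplit := intervalIntegral.integral_Iic_add_Ioi (hi.integrableOn (s := Iic t))
    (hi.integrableOn (s := Ioi t))
  rw [h0] at hsplit
  rw [eq_neg_of_add_eq_zero_left hsplit, norm_neg]
  have hab : a - b₀ < 0 := by linarith
  calc ‖∫ τ in Ioi t, f τ‖ ≤ ∫ τ in Ioi t, ‖f τ‖ := norm_integral_le_integral_norm _
    _ ≤ ∫ τ in Ioi t, C * Real.exp ((a - b₀) * τ) := by
        refine setIntegral_mono_on hi.norm.integrableOn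
          ((integrableOn_exp_mul_Ioi hab t).const_mul C) measurableSet_Ioi fun τ hτ => ?_
        have hτ0 : 0 ≤ τ := ht.trans (mem_Ioi.1 hτ).le
        calc ‖f τ‖ ≤ C * Real.exp (-(b₀ * |τ|)) * Real.exp (a * τ) := hf τ
          _ = C * Real.exp ((a - b₀) * τ) := by
              rw [abs_of_nonneg hτ0, mul_assoc, ← Real.exp_add]
              congr 2
              ring
    _ = C / (b₀ - a) * Real.exp ((a - b₀) * t) := by
        rw [integral_const_mul, integral_exp_mul_Ioi hab]
        have hne : a - b₀ ≠ 0 := hab.ne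
        have hne' : b₀ - a ≠ 0 := hba.ne'
        field_simp
        ring

/-- **Same-rate envelope.** If `‖f(τ)‖ ≤ C e^{−b₀|τ|} e^{(Re w)τ}`, `|Re w| < b₀`, `C ≥ 0` and
`∫ f = 0`, then `‖e^{−wt} ∫_{−∞}^t f‖ ≤ C/(b₀ − |Re w|) · e^{−b₀|t|}` for every `t`. [folklore] -/
theorem mdiv_norm_G_le {f : ℝ → ℂ} (hi : Integrable f) (h0 : ∫ τ, f τ = 0) {C b₀ : ℝ} {w : ℂ}
    (hC : 0 ≤ C) (hf : ∀ τ, ‖f τ‖ ≤ C * Real.exp (-(b₀ * |τ|)) * Real.exp (w.re * τ))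
    (hw : |w.re| < b₀) (t : ℝ) :
    ‖-(cexp (-w * t) * ∫ τ in Iic t, f τ)‖ ≤ C / (b₀ - |w.re|) * Real.exp (-(b₀ * |t|)) := by
  have hpos : 0 < b₀ - |w.re| := sub_pos.2 hw
  have hba : 0 < b₀ + w.re := by have := neg_abs_le w.re; linarith
  have hba' : 0 < b₀ - w.re := by have := le_abs_self w.re; linarith
  rw [norm_neg, norm_mul, Complex.norm_exp,
    show (-w * (t : ℂ)).re = -(w.re * t) by simp [mul_re]]
  rcases le_or_gt t 0 with ht | ht
  · have h1 := mdiv_norm_primitive_le_of_nonpos hi hf hba ht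
    calc Real.exp (-(w.re * t)) * ‖∫ τ in Iic t, f τ‖
        ≤ Real.exp (-(w.re * t)) * (C / (b₀ + w.re) * Real.exp ((b₀ + w.re) * t)) :=
          mul_le_mul_of_nonneg_left h1 (Real.exp_pos _).le
      _ = C / (b₀ + w.re) * Real.exp (-(b₀ * |t|)) := by
          rw [abs_of_nonpos ht, mul_left_comm, ← Real.exp_add]
          congr 2
          ring
      _ ≤ C / (b₀ - |w.re|) * Real.exp (-(b₀ * |t|)) := by
          refine mul_le_mul_of_nonneg_right ?_ (Real.exp_pos _).le
          exact div_le_div_of_nonneg_left hC hpos (by linarith [neg_abs_le w.re])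
  · have h1 := mdiv_norm_primitive_le_of_nonneg hi h0 hf hba' ht.le
    calc Real.exp (-(w.re * t)) * ‖∫ τ in Iic t, f τ‖
        ≤ Real.exp (-(w.re * t)) * (C / (b₀ - w.re) * Real.exp ((w.re - b₀) * t)) :=
          mul_le_mul_of_nonneg_left h1 (Real.exp_pos _).le
      _ = C / (b₀ - w.re) * Real.exp (-(b₀ * |t|)) := by
          rw [abs_of_pos ht, mul_left_comm, ← Real.exp_add]
          congr 2
          ring
      _ ≤ C / (b₀ - |w.re|) * Real.exp (-(b₀ * |t|)) := by
          refine mul_le_mul_of_nonneg_right ?_ (Real.exp_pos _).le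
          exact div_le_div_of_nonneg_left hC hpos (by linarith [le_abs_self w.re])

/-! ## The stub -/

/-- **Stub G5 — `mellin_divide` (RH-free; groundwork for the harmonic weak-limit closure).**  In
the exponential Weil class one can DIVIDE the Mellin transform by a zero: if `F` is in the class
(rate `b₀ > 1/2`) and `F̂(s₀) = 0` at a point of the open critical strip, then
`G(t) = −e^{−(s₀−1/2)t} ∫_{−∞}^t F(τ) e^{(s₀−1/2)τ} dτ ( = +e^{−(s₀−1/2)t} ∫_t^∞ …, by `F̂(s₀) = 0`)`
is again in the class with the same rate (`G′ = −(s₀−½)G − F`), and `F̂(s) = (s − s₀) Ĝ(s)` in the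
closed strip (integration by parts, `weilMellin_of_hasDerivAt`). [folklore] -/
theorem stub_mellin_divide :
    ∀ (F : ℝ → ℂ) (C b₀ : ℝ) (s₀ : ℂ), ContDiff ℝ (⊤ : ℕ∞) F → 1 / 2 < b₀ →
      (∀ t, ‖F t‖ ≤ C * Real.exp (-(b₀ * |t|))) →
      (∀ t, ‖deriv F t‖ ≤ C * Real.exp (-(b₀ * |t|))) →
      (∀ t, ‖deriv (deriv F) t‖ ≤ C * Real.exp (-(b₀ * |t|))) →
      0 < s₀.re → s₀.re < 1 → weilMellin F s₀ = 0 →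
      ∃ G : ℝ → ℂ, ContDiff ℝ (⊤ : ℕ∞) G ∧
        (∃ C' : ℝ, ∀ t, ‖G t‖ ≤ C' * Real.exp (-(b₀ * |t|)) ∧
          ‖deriv G t‖ ≤ C' * Real.exp (-(b₀ * |t|)) ∧
          ‖deriv (deriv G) t‖ ≤ C' * Real.exp (-(b₀ * |t|))) ∧
        (∀ t, deriv G t = -(s₀ - 1 / 2) * G t - F t) ∧
        ∀ s : ℂ, 0 ≤ s.re → s.re ≤ 1 → weilMellin F s = (s - s₀) * weilMellin G s := by
  intro F C b₀ s₀ hF hb h0 h1 _h2 hs0 hs1 hzero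
  have hFd : Differentiable ℝ F := hF.differentiable (by simp)
  have hFc : Continuous F := hFd.continuous
  have hFn : ∀ n : ℕ, ContDiff ℝ n F := contDiff_infty.1 hF
  have hC : 0 ≤ C := by
    have := (norm_nonneg _).trans (h0 0)
    simpa using this
  obtain ⟨w, hw⟩ : ∃ w : ℂ, w = s₀ - 1 / 2 := ⟨_, rfl⟩
  have hwre : w.re = s₀.re - 1 / 2 := by
    rw [hw]
    simp [sub_re]
  have hwabs : |w.re| < b₀ := by
    rw [hwre, abs_lt]
    constructor <;> linarith
  have hpos : 0 < b₀ - |w.re| := sub_pos.2 hwabs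
  -- the integrand `f = F e^{wτ}` of `F̂(s₀)`
  have hfi : Integrable fun τ : ℝ => F τ * cexp (w * τ) := by
    rw [hw]
    exact zsTrunc_integrable_mul_cexp hFc hb h0 hs0.le hs1.le
  have hf0 : ∫ τ : ℝ, F τ * cexp (w * τ) = 0 := by
    rw [hw]
    exact hzero
  have hfb : ∀ τ : ℝ, ‖F τ * cexp (w * τ)‖ ≤ C * Real.exp (-(b₀ * |τ|)) * Real.exp (w.re * τ) := by
    intro τ
    rw [norm_mul, Complex.norm_exp, show (w * (τ : ℂ)).re = w.re * τ by simp [mul_re]]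
    exact mul_le_mul_of_nonneg_right (h0 τ) (Real.exp_pos _).le
  -- `G`
  set G : ℝ → ℂ := fun t => -(cexp (-w * t) * ∫ τ in Iic t, F τ * cexp (w * τ)) with hGdef
  have hGd : ∀ t, HasDerivAt G (-w * G t - F t) t := fun t => mdiv_hasDerivAt_G hFc w hfi t
  have hGdiff : Differentiable ℝ G := fun t => (hGd t).differentiableAt
  have hGc : Continuous G := hGdiff.continuous
  have hGderiv : deriv G = fun t => -w * G t - F t := funext fun t => (hGd t).deriv
  have hGd2 : ∀ t, HasDerivAt (deriv G) (-w * deriv G t - deriv F t) t := by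
    intro t
    rw [hGderiv]
    exact ((hGd t).const_mul (-w)).sub (hFd t).hasDerivAt
  have hGderiv2 : deriv (deriv G) = fun t => -w * deriv G t - deriv F t :=
    funext fun t => (hGd2 t).deriv
  -- envelopes
  set C₁ : ℝ := C / (b₀ - |w.re|) with hC₁
  set C₂ : ℝ := ‖w‖ * C₁ + C with hC₂
  set C₃ : ℝ := ‖w‖ * C₂ + C with hC₃
  have hC₁0 : 0 ≤ C₁ := div_nonneg hC hpos.le
  have hC₂0 : 0 ≤ C₂ := by positivity
  have hC₃0 : 0 ≤ C₃ := by positivity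
  have hGb : ∀ t, ‖G t‖ ≤ C₁ * Real.exp (-(b₀ * |t|)) := fun t =>
    mdiv_norm_G_le hfi hf0 hC hfb hwabs t
  have hG'b' : ∀ t, ‖-w * G t - F t‖ ≤ C₂ * Real.exp (-(b₀ * |t|)) := by
    intro t
    calc ‖-w * G t - F t‖ ≤ ‖-w * G t‖ + ‖F t‖ := norm_sub_le _ _
      _ = ‖w‖ * ‖G t‖ + ‖F t‖ := by rw [norm_mul, norm_neg]
      _ ≤ ‖w‖ * (C₁ * Real.exp (-(b₀ * |t|))) + C * Real.exp (-(b₀ * |t|)) :=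
          add_le_add (mul_le_mul_of_nonneg_left (hGb t) (norm_nonneg _)) (h0 t)
      _ = C₂ * Real.exp (-(b₀ * |t|)) := by rw [hC₂]; ring
  have hG'b : ∀ t, ‖deriv G t‖ ≤ C₂ * Real.exp (-(b₀ * |t|)) := by
    intro t
    rw [hGderiv]
    exact hG'b' t
  have hG''b : ∀ t, ‖deriv (deriv G) t‖ ≤ C₃ * Real.exp (-(b₀ * |t|)) := by
    intro t
    rw [hGderiv2]
    calc ‖-w * deriv G t - deriv F t‖ ≤ ‖-w * deriv G t‖ + ‖deriv F t‖ := norm_sub_le _ _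
      _ = ‖w‖ * ‖deriv G t‖ + ‖deriv F t‖ := by rw [norm_mul, norm_neg]
      _ ≤ ‖w‖ * (C₂ * Real.exp (-(b₀ * |t|))) + C * Real.exp (-(b₀ * |t|)) :=
          add_le_add (mul_le_mul_of_nonneg_left (hG'b t) (norm_nonneg _)) (h1 t)
      _ = C₃ * Real.exp (-(b₀ * |t|)) := by rw [hC₃]; ring
  -- smoothness by bootstrapping `G' = -w G - F`
  have hGn : ∀ n : ℕ, ContDiff ℝ n G := by
    intro n
    induction n with
    | zero => exact contDiff_zero.2 hGc
    | succ n ih =>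
      rw [Nat.cast_succ]
      refine contDiff_succ_iff_deriv.2 ⟨hGdiff, fun h => absurd h (by simp), ?_⟩
      rw [hGderiv]
      exact (contDiff_const.mul ih).sub (hFn n)
  have hGsmooth : ContDiff ℝ (⊤ : ℕ∞) G := contDiff_infty.2 hGn
  refine ⟨G, hGsmooth, ⟨C₁ + C₂ + C₃, fun t => ⟨?_, ?_, ?_⟩⟩, fun t => ?_, fun s hs0' hs1' => ?_⟩
  · exact (hGb t).trans (mul_le_mul_of_nonneg_right (by linarith) (Real.exp_pos _).le)
  · exact (hG'b t).trans (mul_le_mul_of_nonneg_right (by linarith) (Real.exp_pos _).le)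
  · exact (hG''b t).trans (mul_le_mul_of_nonneg_right (by linarith) (Real.exp_pos _).le)
  · rw [← hw]
    exact (hGd t).deriv
  · -- Mellin identity in the closed strip
    have hGi : Integrable fun t : ℝ => G t * cexp ((s - 1 / 2) * t) :=
      zsTrunc_integrable_mul_cexp hGc hb hGb hs0' hs1'
    have hG'c : Continuous fun t => -w * G t - F t := by fun_prop
    have hG'i : Integrable fun t : ℝ => (-w * G t - F t) * cexp ((s - 1 / 2) * t) :=
      zsTrunc_integrable_mul_cexp hG'c hb hG'b' hs0' hs1'
    have hFi : Integrable fun t : ℝ => F t * cexp ((s - 1 / 2) * t) :=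
      zsTrunc_integrable_mul_cexp hFc hb h0 hs0' hs1'
    have key := weilMellin_of_hasDerivAt (h := G) (h' := fun t => -w * G t - F t) hGd hGi hG'i
    have hlin : weilMellin (fun t => -w * G t - F t) s = -w * weilMellin G s - weilMellin F s := by
      unfold weilMellin
      rw [← integral_const_mul, ← integral_sub (hGi.const_mul _) hFi]
      congr 1 with t
      ring
    rw [hlin] at key
    linear_combination -key - (weilMellin G s) * hw

end Summit.RiemannHypothesis.RiemannHypothesis.Theorems.GroundStatesConvergeToXi

end
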